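import Literature.Computability.Cryptography.GoldreichLevinPredictor
import Literature.Computability.Cryptography.GoldreichLevinHidingLen
import Literature.Computability.Cryptography.AffineHashStrings
import Literature.Computability.Cryptography.LiuPassPadding
import HarnessLib

/-!
# The Goldreich–Levin ensembles as counts over `𝔽₂`-vectors (crypto layer, part 1)

Bridge between the string world of `GoldreichLevinHiding.lean` (seeds `x ‖ ρ ‖ σ [‖ u]`,
`glReal`, `glIdeal`, `glBits`, `acceptPMF`) and the vector world of the math layer
`GoldreichLevinPredictor.lean` (`BVec n = Fin n → 𝔽₂`, `dotProduct`): at a level `n` with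
`S_n ≠ ∅` and `g` of fixed output length `ℓ` on the seeds,

  `(Pr[D(1ⁿ, real) = 1] − Pr[D(1ⁿ, ideal) = 1]) · (|S_n|·2^m·2^{Kn}·2^K·2^κ) = 2^K·Re − Id`

(`advantage_mul_eq`), where `Re`, `Id` are the acceptance counts of the deterministic
function `Df x ρ σ v c = D.run ⟨1ⁿ, g(x‖ρ) ‖ blocks σ ‖ bits v⟩ c` of the math layer and
`κ = D.coinLen` at the (common) input length.

* `Stockmeyer.coinEquiv : {0,1}ⁿ ≃ 𝔽₂ⁿ` (`toZ` / `encZ`, `toList_coinEquiv_symm`), `blocksStr σ` (the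
  `K` blocks as one string) and `blocksEquiv : (Fin K → 𝔽₂ⁿ) ≃ {0,1}^{Kn}`, block extraction
  `drop_take_blocksStr`;
* `bz_ipBit : bz ⟨x, encZ v⟩_{ipBit} = toZ x ⬝ᵥ v` and `glBits_blocksStr`: the Goldreich–Levin bits
  of the string are the inner products of the vectors;
* the seed sums `sum_blockSeeds_real` / `sum_blockSeeds_ideal` and `advantage_mul_eq`.

## References

* O. Goldreich, *Foundations of Cryptography I*, CUP 2001, §2.5.2–2.5.3.
* Y. Liu, R. Pass, *On one-way functions and Kolmogorov complexity*, FOCS 2020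
  (arXiv:2009.11514), Appendix, Thm [GL89].
-/

namespace Literature.Computability.Cryptography

open Finset Matrix _root_.Computability Complexity Complexity.Stockmeyer AffineStr

namespace GLEns

variable {n K : ℕ}

/-! ### Vectors of bits and vectors over `𝔽₂` -/

/-- `getD` of `encZ v` inside the range. [folklore] -/
theorem getD_encZ (v : BVec n) (i : Fin n) : (encZ n v).getD i false = decide (v i = 1) := by
  rw [List.getD_eq_getElem?_getD, encZ, List.getElem?_ofFn]
  simp

/-- `encZ (toZ x) = x`. [folklore] -/
theorem encZ_toZ (x : List.Vector Bool n) : encZ n (Stockmeyer.toZ x) = x.toList := by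
  have h : encZ n (Stockmeyer.toZ x) = List.ofFn x.get := by
    unfold encZ Stockmeyer.toZ
    congr 1
    funext i
    simp
  rw [h, ← List.Vector.toList_ofFn, List.Vector.ofFn_get]

/-- `toZ (encZ v) = v`. [folklore] -/
theorem toZ_encZ (v : BVec n) : Stockmeyer.toZ (⟨encZ n v, length_encZ n v⟩ : List.Vector Bool n) = v := by
  funext i
  simp only [Stockmeyer.toZ]
  rw [get_eq_getD, List.Vector.toList_mk, getD_encZ, bz_decide]

/-- The string of `coinEquiv.symm v` is `encZ v` (`Stockmeyer.coinEquiv n : {0,1}ⁿ ≃ 𝔽₂ⁿ` is `toZ`,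
definitionally). [folklore] -/
@[simp] theorem toList_coinEquiv_symm (v : BVec n) : ((coinEquiv n).symm v).toList = encZ n v := by
  show (List.Vector.ofFn _).toList = _
  rw [List.Vector.toList_ofFn]
  rfl

/-- `coinEquiv` is `toZ`. [folklore] -/
theorem coinEquiv_apply (x : List.Vector Bool n) : coinEquiv n x = Stockmeyer.toZ x := rfl

/-- `bz` of the inner-product bit of two lists of equal length, as a sum of products. [folklore] -/
theorem bz_ipBit_list : ∀ (a b : List Bool), a.length = b.length →
    bz (ipBit a b) = ∑ i ∈ Finset.range a.length, bz (a.getD i false) * bz (b.getD i false)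
  | [], b, _ => by simp [ipBit, bz]
  | c :: a, [], h => by simp at h
  | c :: a, e :: b, h => by
    simp only [List.length_cons, Nat.succ.injEq] at h
    rw [ipBit_cons_cons, bz_xor, bz_ipBit_list a b h, List.length_cons, Finset.sum_range_succ', bz_and]
    simp only [List.getD_cons_succ, List.getD_cons_zero]
    rw [add_comm]

/-- **The inner-product bit is the dot product**: `bz (ipBit x (encZ v)) = toZ x ⬝ᵥ v`.
[Goldreich 2001, Thm 2.5.2 (`b(x,r) = Σ xᵢrᵢ mod 2`)] [cite: Goldreich2001, Thm. 2.5.2] -/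
theorem bz_ipBit (x : List.Vector Bool n) (v : BVec n) : bz (ipBit x.toList (encZ n v)) = Stockmeyer.toZ x ⬝ᵥ v := by
  rw [bz_ipBit_list _ _ (by simp), List.Vector.toList_length, Finset.sum_range, dotProduct]
  refine Finset.sum_congr rfl fun i _ => ?_
  simp only [Stockmeyer.toZ]
  rw [get_eq_getD, getD_encZ, bz_decide]

/-- `ipBit x (encZ v)` as a Boolean. [folklore] -/
theorem ipBit_encZ (x : List.Vector Bool n) (v : BVec n) : ipBit x.toList (encZ n v) = decide (Stockmeyer.toZ x ⬝ᵥ v = 1) := by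
  rw [← bz_ipBit]
  cases ipBit x.toList (encZ n v) <;> decide

/-! ### Blocks -/

/-- The `K` seed blocks as one string `σ₀ ‖ … ‖ σ_{K−1}`. [folklore] -/
def blocksStr (σ : Fin K → BVec n) : List Bool := (List.ofFn fun j => encZ n (σ j)).flatten

/-- `|blocksStr σ| = K·n`. [folklore] -/
@[simp] theorem length_blocksStr (σ : Fin K → BVec n) : (blocksStr σ).length = K * n := by
  simp [blocksStr, List.length_flatten, Function.comp_def]

/-- Block extraction from a concatenation of blocks of equal length. [folklore] -/
theorem drop_take_flatten_ofFn : ∀ {K : ℕ} (f : Fin K → List Bool) (hf : ∀ j, (f j).length = n) (j : Fin K),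
    ((List.ofFn f).flatten.drop (j * n)).take n = f j
  | 0, _, _, j => j.elim0
  | K + 1, f, hf, j => by
    rw [List.ofFn_succ, List.flatten_cons]
    refine Fin.cases ?_ (fun j' => ?_) j
    · simp only [Fin.val_zero, Nat.zero_mul, List.drop_zero]
      rw [List.take_append_of_le_length (by rw [hf]), ← hf 0, List.take_length]
    · rw [Fin.val_succ, Nat.succ_mul, Nat.add_comm, ← List.drop_drop, ← hf 0, List.drop_left,
        hf 0]
      exact drop_take_flatten_ofFn (fun i => f i.succ) (fun i => hf i.succ) j'

/-- **Block `j` of `blocksStr σ` is `encZ (σ j)`.** [folklore] -/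
theorem drop_take_blocksStr (σ : Fin K → BVec n) (j : Fin K) : ((blocksStr σ).drop (j * n)).take n = encZ n (σ j) :=
  drop_take_flatten_ofFn _ (fun j => length_encZ n (σ j)) j

/-- `blocksStr` is injective. [folklore] -/
theorem blocksStr_injective : Function.Injective (blocksStr (n := n) (K := K)) := by
  intro σ σ' h
  funext j
  apply encZ_injective n
  rw [← drop_take_blocksStr σ j, ← drop_take_blocksStr σ' j, h]

/-- **`(Fin K → 𝔽₂ⁿ) ≃ {0,1}^{Kn}`** by `blocksStr` (injective between sets of equal size). [folklore] -/
noncomputable def blocksEquiv (n K : ℕ) : (Fin K → BVec n) ≃ List.Vector Bool (K * n) :=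
  Equiv.ofBijective (fun σ => ⟨blocksStr σ, length_blocksStr σ⟩) (by
    rw [Fintype.bijective_iff_injective_and_card]
    refine ⟨fun σ σ' h => blocksStr_injective (congrArg List.Vector.toList h), ?_⟩
    have hB : Fintype.card (BVec n) = 2 ^ n := by simp [BVec, ZMod.card]
    rw [Fintype.card_fun, Fintype.card_fin, card_vector, Fintype.card_bool, hB, ← pow_mul, mul_comm])

/-- The string of `blocksEquiv σ`. [folklore] -/
@[simp] theorem toList_blocksEquiv (σ : Fin K → BVec n) : (blocksEquiv n K σ).toList = blocksStr σ := rfl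

/-- **The Goldreich–Levin bits of the block string are the inner products.** [folklore] -/
theorem glBits_blocksStr (x : List.Vector Bool n) (σ : Fin K → BVec n) :
    glBits K n x.toList (blocksStr σ) = encZ K fun j => Stockmeyer.toZ x ⬝ᵥ σ j := by
  unfold glBits encZ
  rw [List.ofFn_eq_map, ← List.map_coe_finRange_eq_range, List.map_map]
  refine List.map_congr_left fun j _ => ?_
  simp only [Function.comp_apply, drop_take_blocksStr, ipBit_encZ]

/-! ### Sums over block seeds -/

/-- A sum over `blockSeeds S b n` is a sum over `(x, τ)`. [folklore] -/
theorem sum_blockSeeds {M : Type*} [AddCommMonoid M] (S : ∀ n : ℕ, Finset (List.Vector Bool n)) (b n : ℕ) (F : List Bool → M) :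
    ∑ w ∈ blockSeeds S b n, F w = ∑ x ∈ S n, ∑ τ : List.Vector Bool b, F (x.toList ++ τ.toList) := by
  classical
  unfold blockSeeds
  rw [Finset.sum_image (by simpa [Finset.coe_product] using blockSeeds_map_injective S b n), Finset.sum_product]

/-- **Real seeds as `(x, ρ, σ)`**: `Σ_{w ∈ blockSeeds S (m + Kn) n} F(w) = Σ_x Σ_ρ Σ_σ F(x ‖ ρ ‖ blocks σ)`. [folklore] -/
theorem sum_blockSeeds_real {M : Type*} [AddCommMonoid M] (S : ∀ n : ℕ, Finset (List.Vector Bool n)) (mm K n : ℕ) (F : List Bool → M) :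
    ∑ w ∈ blockSeeds S (mm + K * n) n, F w =
      ∑ x ∈ S n, ∑ ρ : List.Vector Bool mm, ∑ σ : Fin K → BVec n, F (x.toList ++ ρ.toList ++ blocksStr σ) := by
  rw [sum_blockSeeds]
  refine Finset.sum_congr rfl fun x _ => ?_
  have h := sum_vector_add (M := M) mm (K * n) (fun u w => F (x.toList ++ u ++ w))
  simp only [List.append_assoc, List.take_append_drop] at h
  rw [h]
  refine Finset.sum_congr rfl fun ρ _ => ?_
  rw [← Fintype.sum_equiv (blocksEquiv n K) (fun σ => F (x.toList ++ (ρ.toList ++ blocksStr σ)))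
    (fun s => F (x.toList ++ (ρ.toList ++ s.toList))) (fun σ => rfl)]
  simp only [List.append_assoc]

/-- A sum over `{0,1}^K` as a sum over `𝔽₂^K`. [folklore] -/
theorem sum_vector_eq_sum_bvec {M : Type*} [AddCommMonoid M] (K : ℕ) (G : List Bool → M) :
    ∑ u : List.Vector Bool K, G u.toList = ∑ v : BVec K, G (encZ K v) :=
  Fintype.sum_equiv (coinEquiv K) _ _ fun u => by rw [coinEquiv_apply, encZ_toZ]

/-- **Ideal seeds as `(x, ρ, σ, v)`**:
`Σ_{w ∈ blockSeeds S (m + (Kn + K)) n} F(w) = Σ_x Σ_ρ Σ_σ Σ_v F(x ‖ ρ ‖ blocks σ ‖ encZ v)`. [folklore] -/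
theorem sum_blockSeeds_ideal {M : Type*} [AddCommMonoid M] (S : ∀ n : ℕ, Finset (List.Vector Bool n)) (mm K n : ℕ) (F : List Bool → M) :
    ∑ w ∈ blockSeeds S (mm + (K * n + K)) n, F w =
      ∑ x ∈ S n, ∑ ρ : List.Vector Bool mm, ∑ σ : Fin K → BVec n, ∑ v : BVec K,
        F (x.toList ++ ρ.toList ++ blocksStr σ ++ encZ K v) := by
  rw [sum_blockSeeds]
  refine Finset.sum_congr rfl fun x _ => ?_
  have h := sum_vector_add (M := M) mm (K * n + K) (fun u w => F (x.toList ++ u ++ w))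
  simp only [List.append_assoc, List.take_append_drop] at h
  rw [h]
  refine Finset.sum_congr rfl fun ρ _ => ?_
  have h2 := sum_vector_add (M := M) (K * n) K (fun u w => F (x.toList ++ (ρ.toList ++ (u ++ w))))
  simp only [List.take_append_drop] at h2
  rw [h2, ← Fintype.sum_equiv (blocksEquiv n K) (fun σ => ∑ w : List.Vector Bool K, F (x.toList ++ (ρ.toList ++ (blocksStr σ ++ w.toList))))
    (fun s => ∑ w : List.Vector Bool K, F (x.toList ++ (ρ.toList ++ (s.toList ++ w.toList)))) (fun σ => rfl)]
  refine Finset.sum_congr rfl fun σ _ => ?_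
  rw [sum_vector_eq_sum_bvec K (fun u => F (x.toList ++ (ρ.toList ++ (blocksStr σ ++ u))))]
  simp only [List.append_assoc]

/-! ### The distinguisher as a deterministic function and the acceptance counts -/

section Counts

variable (D : RandAlg (List Bool) Bool) (g : List Bool → List Bool) (S : ∀ n : ℕ, Finset (List.Vector Bool n)) (n mm K κ : ℕ)

/-- **The distinguisher as a function of `(x, ρ, σ, v, c)`**: `D(1ⁿ, g(x‖ρ) ‖ blocks σ ‖ bits v; c)`
(the `Df` of the math layer `GoldreichLevinPredictor.lean`, with the secrets indexed by `S_n`).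
[Goldreich 2001, §2.5.3] [cite: Goldreich2001, Thm. 2.5.6 (proof, Section 2.5.3)] -/
def Df (x : ↥(S n)) (ρ : List.Vector Bool mm) (σ : Fin K → BVec n) (v : BVec K) (c : List.Vector Bool κ) : Bool :=
  D.run (boolPair (unaryEncodeNat n) (g (x.1.toList ++ ρ.toList) ++ blocksStr σ ++ encZ K v)) c.toList

/-- The secret as a vector over `𝔽₂`. [folklore] -/
def sec (x : ↥(S n)) : BVec n := Stockmeyer.toZ x.1

/-- The real acceptance count `Re = #{(x, ρ, σ, c) : D accepts the real sample}`. [folklore] -/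
noncomputable def ReTot : ℕ :=
  (univ.filter fun q : ↥(S n) × List.Vector Bool mm × (Fin K → BVec n) × List.Vector Bool κ =>
    Df D g S n mm K κ q.1 q.2.1 q.2.2.1 (fun j => sec S n q.1 ⬝ᵥ q.2.2.1 j) q.2.2.2 = true).card

/-- The ideal acceptance count `Id = #{(x, ρ, σ, v, c) : D accepts the ideal sample}`. [folklore] -/
noncomputable def IdTot : ℕ :=
  (univ.filter fun q : ↥(S n) × List.Vector Bool mm × (Fin K → BVec n) × BVec K × List.Vector Bool κ =>
    Df D g S n mm K κ q.1 q.2.1 q.2.2.1 q.2.2.2.1 q.2.2.2.2 = true).card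

variable {D g S n mm K κ}

/-- A `RandAlg` acceptance probability as a count of accepting coin strings. [folklore] -/
theorem pr_true_eq_card (z : List Bool) (hκ : D.coinLen z.length = κ) :
    D.pr id z {true} = ((univ.filter fun c : List.Vector Bool κ => D.run z c.toList = true).card : ℝ) / 2 ^ κ := by
  rw [D.pr_eq_card_filter_div id z {true} hκ]
  simp only [Set.mem_singleton_iff]

/-- **`Pr[D(1ⁿ, real) = 1] · (|S_n| 2^m 2^{Kn} 2^κ) = Re`** when `g` has output length `ℓ` on the
seeds and `κ = D.coinLen` at the input length `2n + 2 + (ℓ + Kn + K)`. [folklore] -/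
theorem prReal_mul_eq {ℓ : ℕ} (hS : (S n).Nonempty)
    (hg : ∀ x ∈ S n, ∀ ρ : List.Vector Bool mm, (g (x.toList ++ ρ.toList)).length = ℓ)
    (hκ : D.coinLen (2 * n + 2 + (ℓ + K * n + K)) = κ) :
    (acceptPMF D n ((condUniform (blockSeeds S (mm + K * n) n)).map (glReal g mm K n)) true).toReal *
        ((S n).card * 2 ^ mm * 2 ^ (K * n) * 2 ^ κ) = ReTot D g S n mm K κ := by
  classical
  have hbS : (blockSeeds S (mm + K * n) n).Nonempty := blockSeeds_nonempty_iff.2 hS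
  rw [toReal_acceptPMF_condUniform_map D n hbS, sum_blockSeeds_real, card_blockSeeds]
  -- each seed: the real sample and its acceptance count
  have hterm : ∀ x ∈ S n, ∀ (ρ : List.Vector Bool mm) (σ : Fin K → BVec n),
      D.pr id (boolPair (unaryEncodeNat n) (glReal g mm K n (x.toList ++ ρ.toList ++ blocksStr σ))) {true} =
        ((univ.filter fun c : List.Vector Bool κ => D.run (boolPair (unaryEncodeNat n)
          (g (x.toList ++ ρ.toList) ++ blocksStr σ ++ encZ K fun j => Stockmeyer.toZ x ⬝ᵥ σ j)) c.toList = true).card : ℝ) / 2 ^ κ := by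
    intro x hx ρ σ
    have hseed := glReal_seed g x ρ (blocksEquiv n K σ)
    rw [toList_blocksEquiv] at hseed
    rw [hseed, glBits_blocksStr]
    apply pr_true_eq_card
    rw [length_boolPair, show (unaryEncodeNat n).length = n from unary_decode_encode_nat n, List.length_append,
      List.length_append, hg x hx ρ, length_blocksStr, length_encZ, ← hκ]
  rw [Finset.sum_congr rfl fun x hx => Finset.sum_congr rfl fun ρ _ => Finset.sum_congr rfl fun σ _ => hterm x hx ρ σ]
  -- the count as an iterated sum
  have hRe : (ReTot D g S n mm K κ : ℝ) = ∑ x ∈ S n, ∑ ρ : List.Vector Bool mm, ∑ σ : Fin K → BVec n,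
      ((univ.filter fun c : List.Vector Bool κ => D.run (boolPair (unaryEncodeNat n)
          (g (x.toList ++ ρ.toList) ++ blocksStr σ ++ encZ K fun j => Stockmeyer.toZ x ⬝ᵥ σ j)) c.toList = true).card : ℝ) := by
    unfold ReTot
    rw [Finset.natCast_card_filter, Fintype.sum_prod_type, ← Finset.sum_coe_sort (S n)]
    refine Finset.sum_congr rfl fun x _ => ?_
    rw [Fintype.sum_prod_type]
    refine Finset.sum_congr rfl fun ρ _ => ?_
    rw [Fintype.sum_prod_type]
    refine Finset.sum_congr rfl fun σ _ => ?_
    rw [Finset.natCast_card_filter]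
    rfl
  rw [hRe]
  have hS0 : ((S n).card : ℝ) ≠ 0 := by exact_mod_cast hS.card_pos.ne'
  simp only [← Finset.sum_div, Nat.cast_mul, Nat.cast_pow, Nat.cast_ofNat, pow_add]
  field_simp

/-- **`Pr[D(1ⁿ, ideal) = 1] · (|S_n| 2^m 2^{Kn} 2^K 2^κ) = Id`.** [folklore] -/
theorem prIdeal_mul_eq {ℓ : ℕ} (hS : (S n).Nonempty)
    (hg : ∀ x ∈ S n, ∀ ρ : List.Vector Bool mm, (g (x.toList ++ ρ.toList)).length = ℓ)
    (hκ : D.coinLen (2 * n + 2 + (ℓ + K * n + K)) = κ) :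
    (acceptPMF D n ((condUniform (blockSeeds S (mm + K * n + K) n)).map (glIdeal g mm n)) true).toReal *
        ((S n).card * 2 ^ mm * 2 ^ (K * n) * 2 ^ K * 2 ^ κ) = IdTot D g S n mm K κ := by
  classical
  have hbS : (blockSeeds S (mm + K * n + K) n).Nonempty := blockSeeds_nonempty_iff.2 hS
  rw [toReal_acceptPMF_condUniform_map D n hbS, card_blockSeeds, Nat.add_assoc, sum_blockSeeds_ideal]
  have hterm : ∀ x ∈ S n, ∀ (ρ : List.Vector Bool mm) (σ : Fin K → BVec n) (v : BVec K),
      D.pr id (boolPair (unaryEncodeNat n) (glIdeal g mm n (x.toList ++ ρ.toList ++ blocksStr σ ++ encZ K v))) {true} =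
        ((univ.filter fun c : List.Vector Bool κ => D.run (boolPair (unaryEncodeNat n)
          (g (x.toList ++ ρ.toList) ++ blocksStr σ ++ encZ K v)) c.toList = true).card : ℝ) / 2 ^ κ := by
    intro x hx ρ σ v
    rw [List.append_assoc (x.toList ++ ρ.toList), glIdeal_seed g x ρ, ← List.append_assoc]
    apply pr_true_eq_card
    rw [length_boolPair, show (unaryEncodeNat n).length = n from unary_decode_encode_nat n, List.length_append,
      List.length_append, hg x hx ρ, length_blocksStr, length_encZ, ← hκ]
  rw [Finset.sum_congr rfl fun x hx => Finset.sum_congr rfl fun ρ _ => Finset.sum_congr rfl fun σ _ =>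
    Finset.sum_congr rfl fun v _ => hterm x hx ρ σ v]
  have hId : (IdTot D g S n mm K κ : ℝ) = ∑ x ∈ S n, ∑ ρ : List.Vector Bool mm, ∑ σ : Fin K → BVec n, ∑ v : BVec K,
      ((univ.filter fun c : List.Vector Bool κ => D.run (boolPair (unaryEncodeNat n)
          (g (x.toList ++ ρ.toList) ++ blocksStr σ ++ encZ K v)) c.toList = true).card : ℝ) := by
    unfold IdTot
    rw [Finset.natCast_card_filter, Fintype.sum_prod_type, ← Finset.sum_coe_sort (S n)]
    refine Finset.sum_congr rfl fun x _ => ?_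
    rw [Fintype.sum_prod_type]
    refine Finset.sum_congr rfl fun ρ _ => ?_
    rw [Fintype.sum_prod_type]
    refine Finset.sum_congr rfl fun σ _ => ?_
    rw [Fintype.sum_prod_type]
    refine Finset.sum_congr rfl fun v _ => ?_
    rw [Finset.natCast_card_filter]
    rfl
  rw [hId]
  have hS0 : ((S n).card : ℝ) ≠ 0 := by exact_mod_cast hS.card_pos.ne'
  simp only [← Finset.sum_div, Nat.cast_mul, Nat.cast_pow, Nat.cast_ofNat, pow_add]
  field_simp

/-- **The distinguishing gap as a difference of counts**:
`(Pr[D real] − Pr[D ideal]) · |S_n| 2^m 2^{Kn} 2^K 2^κ = 2^K·Re − Id`. [Goldreich 2001, §2.5.3] [cite: Goldreich2001, Thm. 2.5.6 (proof, Section 2.5.3)] -/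
theorem advantage_mul_eq {ℓ : ℕ} (hS : (S n).Nonempty)
    (hg : ∀ x ∈ S n, ∀ ρ : List.Vector Bool mm, (g (x.toList ++ ρ.toList)).length = ℓ)
    (hκ : D.coinLen (2 * n + 2 + (ℓ + K * n + K)) = κ) :
    ((acceptPMF D n ((condUniform (blockSeeds S (mm + K * n) n)).map (glReal g mm K n)) true).toReal -
        (acceptPMF D n ((condUniform (blockSeeds S (mm + K * n + K) n)).map (glIdeal g mm n)) true).toReal) *
        ((S n).card * 2 ^ mm * 2 ^ (K * n) * 2 ^ K * 2 ^ κ) =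
      2 ^ K * (ReTot D g S n mm K κ : ℝ) - IdTot D g S n mm K κ := by
  rw [sub_mul, ← prReal_mul_eq hS hg hκ, ← prIdeal_mul_eq hS hg hκ]
  ring

end Counts

end GLEns

end Literature.Computability.Cryptography
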